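import Literature.MathematicalPhysics.KineticTheory.EvenCollisionTubeFunctional
import Literature.MathematicalPhysics.KineticTheory.HardSphereEulerProofs
import Summits.AtomisticToContinuum.HydrodynamicLimit.Theses.JParityClosure
import Summits.AtomisticToContinuum.HydrodynamicLimit.Theorems.JParityClosureOddContactSymmetryGibbsInvariance
import Summits.AtomisticToContinuum.HydrodynamicLimit.Theorems.JParityClosureOddContactSymmetryTubeStatRegular
import Summits.AtomisticToContinuum.HydrodynamicLimit.Theorems.JParityClosureEvenStressEnskogTubeStatRegular
import Summits.AtomisticToContinuum.HydrodynamicLimit.Theorems.JParityClosureEvenStressEnskogEnskogRateMeanRung0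
import Summits.AtomisticToContinuum.HydrodynamicLimit.Theorems.ImplosionDichotomyHsEosLowDensity
import Summits.AtomisticToContinuum.HydrodynamicLimit.Theorems.EvenStressEnskog.Negative.ContactValueZero
import Literature.Analysis.FluidPDE.SphereMeasureSymmetry
import HarnessLib
import Summits.AtomisticToContinuum.HydrodynamicLimit.Theorems.JParityClosureEvenStressEnskogContactBridge

/-!
# S3 at rung 0, conditional on the canonical contact theorem and the tube-side mean — the ASSEMBLY behind H6

Crux stmt-AtomisticToContinuum-13079 (`JParityClosure.EvenStressEnskog`), line `even-rung-mean-variance`, stub S3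
`stub_meanEnskog` (the bet).  RUNG 0 = constant profiles `(a, u, θ)`: the local Gibbs law is the homogeneous canonical
Gibbs law `G_N`, invariant under every hard-sphere flow (`Theorems.map_flow_localGibbsLaw_const`), so the time-integrated
mean `∫₀^τ E_{G_N}[W_t ∘ Φ_t] dt` of the even tube functional `W_t = A_t − σ³ e_t` is the STATIC quantity
`∫₀^τ (E_{G_N} A_t − σ³ E_{G_N} e_t) dt`; the Enskog side `E e_t` tends to `(∫χ(t,·)) g(σ³) Y(σ³) Θ̄_L` (helper stub H4,
`stub_enskogRateMeanRung0`) and the tube side `∫₀^τ E A_t` to `σ³ g(σ³) Y(σ³) Θ̄_L ∫₀^τ∫χ` CONDITIONALLY on the canonical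
contact theorem (helper stub H5, `stub_tubeMeanRung0OfContact`), whence S3 at rung 0 modulo the contact theorem
(registered helper stub H6 `stub_meanEnskogRung0OfContact`).  This file proves the assembly with the landed S6 and H4 IMPORTED and
the conclusion of H5 and the contact theorem as HYPOTHESES (their registered texts, inlined); H6 is then a one-liner once H5 lands.
-/

noncomputable section

open MeasureTheory Set Filter Topology
open scoped ENNReal InnerProductSpace BigOperators Pointwise

namespace Summit.AtomisticToContinuum.HydrodynamicLimit.Theorems.EvenStressEnskog

open Literature.Analysis.FluidPDE Literature.MathematicalPhysics.KineticTheory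
open Summit.AtomisticToContinuum.HydrodynamicLimit.Theses.JParityClosure

/-! ## An `N`-uniform bound for the Enskog rate functional -/

/-- `|B_r Ξ_L (z, x₀)| ≤ (3/(πr³))² · 2L·2L·|S²|`, uniformly in `N` and in the configuration. [folklore] -/
theorem abs_pairFunctional_le_unif {N : ℕ} (k l : Fin 3) {L r : ℝ} (hL : 0 ≤ L) (hr : 0 < r)
    (z : Config (N + 1) (Fin 3) T3) (x₀ : UnitAddTorus (Fin 3)) :
    |pairFunctional r (evenMarkTrunc k l L) z x₀| ≤
      (3 / (Real.pi * r ^ 3)) ^ 2 *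
        (2 * L * (2 * L) * (sphereMeasure : Measure (Metric.sphere (0 : V3) 1)).real univ) := by
  haveI : IsProbabilityMeasure (empiricalMeasure z) := isProbabilityMeasure_empiricalMeasure (by omega) z
  set C := (3 / (Real.pi * r ^ 3)) ^ 2 *
    (2 * L * (2 * L) * (sphereMeasure : Measure (Metric.sphere (0 : V3) 1)).real univ) with hC
  have h := norm_integral_le_of_norm_le_const
    (μ := (empiricalMeasure z).prod (empiricalMeasure z))
    (f := fun p : (T3 × V3) × (T3 × V3) =>
      coneKernel r p.1.1 x₀ * coneKernel r p.2.1 x₀ * sphereMark (evenMarkTrunc k l L) p.1.2 p.2.2)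
    (C := C) (Eventually.of_forall fun p => ?_)
  · have hmass : ((empiricalMeasure z).prod (empiricalMeasure z)).real univ = 1 := by
      rw [probReal_univ]
    simpa only [Real.norm_eq_abs, pairFunctional, hmass, mul_one] using h
  · rw [Real.norm_eq_abs, abs_mul, abs_mul, hC, sq]
    have h1 := abs_coneKernel_le hr p.1.1 x₀
    have h2 := abs_coneKernel_le hr p.2.1 x₀
    have h3 := abs_sphereMark_evenMarkTrunc_le k l hL p.1.2 p.2.2
    exact mul_le_mul (mul_le_mul h1 h2 (abs_nonneg _) (by positivity)) h3 (abs_nonneg _) (by positivity)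

/-! ## A uniform-in-`N` bound for the Enskog rate functional -/

/-- A uniform-in-`N` bound for the Enskog rate functional of the truncated mark. [folklore] -/
theorem abs_enskogRate_le_unif {σ : ℝ} {χ : ℝ × UnitAddTorus (Fin 3) → ℝ} {g : ℝ → ℝ} (k l : Fin 3)
    {L r Cχ CgY : ℝ} {t : ℝ} (hχb : ∀ x, |χ (t, x)| ≤ Cχ)
    (hgY : ∀ a, 0 ≤ a → |g a * contactValue a| ≤ CgY)
    (hσ : 0 ≤ σ) (hL : 0 ≤ L) (hr : 0 < r) (N : ℕ) (z : Config (N + 1) (Fin 3) T3) :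
    |enskogRate σ N χ g (evenMarkTrunc k l L) r t z| ≤
      Cχ * CgY * ((3 / (Real.pi * r ^ 3)) ^ 2 *
        (2 * L * (2 * L) * (sphereMeasure : Measure (Metric.sphere (0 : V3) 1)).real univ)) *
        (volume : Measure (UnitAddTorus (Fin 3))).real univ := by
  set CB := (3 / (Real.pi * r ^ 3)) ^ 2 *
    (2 * L * (2 * L) * (sphereMeasure : Measure (Metric.sphere (0 : V3) 1)).real univ) with hCB
  have hCχ0 : 0 ≤ Cχ := (abs_nonneg _).trans (hχb (z 0).1)
  have hCgY0 : 0 ≤ CgY := (abs_nonneg _).trans (hgY 0 le_rfl)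
  unfold enskogRate
  have h := norm_integral_le_of_norm_le_const (μ := (volume : Measure (UnitAddTorus (Fin 3))))
    (f := fun x => χ (t, x) * g (σ ^ 3 * mollDensity r z x) * contactValue (σ ^ 3 * mollDensity r z x) *
      pairFunctional r (evenMarkTrunc k l L) z x)
    (C := Cχ * CgY * CB) (Eventually.of_forall fun x => ?_)
  · simpa only [Real.norm_eq_abs] using h
  · rw [Real.norm_eq_abs, mul_assoc (χ (t, x)), abs_mul, abs_mul]
    have ha : 0 ≤ σ ^ 3 * mollDensity r z x := mul_nonneg (pow_nonneg hσ 3) (mollDensity_nonneg hr z x)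
    exact mul_le_mul (mul_le_mul (hχb _) (hgY _ ha) (abs_nonneg _) hCχ0)
      (abs_pairFunctional_le_unif k l hL hr z x) (abs_nonneg _) (by positivity)

/-! ## The assembly -/

/-- **S3 at rung 0 from the tube-side mean (H5's conclusion, hypothesis `hH5`) and the canonical contact theorem in phase-space
form (hypothesis `hC`)**, using the landed S6 (`stub_evenTubeStatRegular`, regularity/bounds) and H4 (`stub_enskogRateMeanRung0`,
Enskog-side mean): the assembly behind the registered helper stub H6 `stub_meanEnskogRung0OfContact` of the crux line
`even-rung-mean-variance` (which is the one-liner `fun hC => meanEnskogRung0_of_tubeMean stub_tubeMeanRung0OfContact hC` once H5 lands). -/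
theorem meanEnskogRung0_of_tubeMean :
    ((∃ σ₁ : ℝ, 0 < σ₁ ∧ ∀ σ : ℝ, 0 < σ → σ < σ₁ → ∀ ζ : ℝ, 0 < ζ → ∃ δ₁ : ℝ, 0 < δ₁ ∧ ∀ δ : ℝ, 0 < δ → δ ≤ δ₁ →
      ∃ N₀ : ℕ, ∀ N : ℕ, N₀ ≤ N → ∀ (a θ : ℝ) (u : V3), 0 < a → 0 < θ →
      ∀ Φ : HardSphereFlow (Torus.geometry (Fin 3)) (hsDiameter σ N) (N + 1),
      ∀ i j : Fin (N + 1), i ≠ j → ∀ S : Set V3, MeasurableSet S → S ⊆ {q | 1 < ‖q‖ ∧ ‖q‖ ≤ 1 + δ} →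
        |(localGibbsLaw σ (fun _ => a) (fun _ => u) (fun _ => θ) N Φ).real
            {z | Torus.reprSym ((z i).1 - (z j).1) ∈ hsDiameter σ N • S}
          - contactValue (σ ^ 3) * hsDiameter σ N ^ 3 * (volume S).toReal|
          ≤ ζ * hsDiameter σ N ^ 3 * (volume S).toReal) →
      ∃ η₁ : ℝ, 0 < η₁ ∧ ∃ σ₀ : ℝ, 0 < σ₀ ∧ ∀ (σ a θ : ℝ) (u : V3) (τ : ℝ) (χ : ℝ × UnitAddTorus (Fin 3) → ℝ)
      (g : ℝ → ℝ) (k l : Fin 3) (L r : ℝ),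
      0 < σ → σ < σ₀ → σ ^ 3 < η₁ → 0 < a → 0 < θ → 0 < τ → Continuous χ → Continuous g →
      (∀ b, η₁ ≤ b → g b = 0) → 1 ≤ L → 0 < r → r < 1 / 4 →
      ∀ η : ℝ, 0 < η → ∃ κ₀ : ℝ, 0 < κ₀ ∧ ∀ κ : ℝ, 0 < κ → κ < κ₀ →
      ∀ Φ : (N : ℕ) → HardSphereFlow (Torus.geometry (Fin 3)) (hsDiameter σ N) (N + 1), ∃ N₀ : ℕ, ∀ N : ℕ, N₀ ≤ N →
        |(∫ t in Set.Icc (0 : ℝ) τ, ∫ z, tubeStat σ N χ g (evenMarkTrunc k l L) r r 1 κ t z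
            ∂(localGibbsLaw σ (fun _ => a) (fun _ => u) (fun _ => θ) N (Φ N)))
          - σ ^ 3 * g (σ ^ 3) * contactValue (σ ^ 3) *
            (∫ p : V3 × V3, sphereMark (evenMarkTrunc k l L) p.1 p.2 *
              (localMaxwellian 1 θ u p.1 * localMaxwellian 1 θ u p.2)) *
            ∫ t in Set.Icc (0 : ℝ) τ, ∫ x : UnitAddTorus (Fin 3), χ (t, x)| ≤ η) →
    (∃ σ₁ : ℝ, 0 < σ₁ ∧ ∀ σ : ℝ, 0 < σ → σ < σ₁ → ∀ ζ : ℝ, 0 < ζ → ∃ δ₁ : ℝ, 0 < δ₁ ∧ ∀ δ : ℝ, 0 < δ → δ ≤ δ₁ →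
      ∃ N₀ : ℕ, ∀ N : ℕ, N₀ ≤ N → ∀ (a θ : ℝ) (u : V3), 0 < a → 0 < θ →
      ∀ Φ : HardSphereFlow (Torus.geometry (Fin 3)) (hsDiameter σ N) (N + 1),
      ∀ i j : Fin (N + 1), i ≠ j → ∀ S : Set V3, MeasurableSet S → S ⊆ {q | 1 < ‖q‖ ∧ ‖q‖ ≤ 1 + δ} →
        |(localGibbsLaw σ (fun _ => a) (fun _ => u) (fun _ => θ) N Φ).real
            {z | Torus.reprSym ((z i).1 - (z j).1) ∈ hsDiameter σ N • S}
          - contactValue (σ ^ 3) * hsDiameter σ N ^ 3 * (volume S).toReal|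
          ≤ ζ * hsDiameter σ N ^ 3 * (volume S).toReal) →
    ∃ η₀ : ℝ, 0 < η₀ ∧ ∀ (a θ : ℝ) (u : V3), 0 < a → 0 < θ → ∃ σ₀ : ℝ, 0 < σ₀ ∧ ∀ σ : ℝ, 0 < σ → σ < σ₀ →
      ∀ Φ : (N : ℕ) → HardSphereFlow (Torus.geometry (Fin 3)) (hsDiameter σ N) (N + 1),
      ∀ τ : ℝ, 0 < τ → ∀ χ : ℝ × UnitAddTorus (Fin 3) → ℝ, Continuous χ → ∀ g : ℝ → ℝ, Continuous g →
      (∀ b, η₀ ≤ b → g b = 0) →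
      ∀ η : ℝ, 0 < η → ∃ r₀ : ℝ, 0 < r₀ ∧ ∀ r : ℝ, 0 < r → r < r₀ →
      ∀ L : ℝ, 1 ≤ L → ∃ κ₀ : ℝ, 0 < κ₀ ∧ ∀ κ : ℝ, 0 < κ → κ < κ₀ → ∃ N₀ : ℕ, ∀ N : ℕ, N₀ ≤ N →
      ∀ k l : Fin 3,
        |∫ t in Set.Icc (0 : ℝ) τ,
            ∫ z, evenTubeStat σ N χ g (evenMarkTrunc k l L) r κ t ((Φ N).flow t z)
              ∂(localGibbsLaw σ (fun _ => a) (fun _ => u) (fun _ => θ) N (Φ N))| ≤ η  := by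
  intro hH5 hC
  have hEos : HsEosLowDensity := Summit.AtomisticToContinuum.HydrodynamicLimit.Theorems.hsEosLowDensity_proof
  obtain ⟨η₆, hη₆, H6⟩ := stub_evenTubeStatRegular hEos
  obtain ⟨η₄, hη₄, σ₄, hσ₄, H4⟩ := stub_enskogRateMeanRung0 hEos
  obtain ⟨η₅, hη₅, σ₅, hσ₅, H5⟩ := hH5 hC
  obtain ⟨ηY, hηY, HY⟩ := exists_bound_mul_contactValue hEos
  refine ⟨min (min (min η₄ η₅) η₆) ηY, lt_min (lt_min (lt_min hη₄ hη₅) hη₆) hηY, ?_⟩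
  intro a θ u ha hθ
  refine ⟨min (min σ₄ σ₅) (min (1 / 2) (min η₄ η₅)),
    lt_min (lt_min hσ₄ hσ₅) (lt_min (by norm_num) (lt_min hη₄ hη₅)), ?_⟩
  intro σ hσ hσlt Φ τ hτ χ hχ g hg hg0 η hη
  -- thresholds
  have hσ4 : σ < σ₄ := lt_of_lt_of_le hσlt ((min_le_left _ _).trans (min_le_left _ _))
  have hσ5 : σ < σ₅ := lt_of_lt_of_le hσlt ((min_le_left _ _).trans (min_le_right _ _))
  have hσhalf : σ ≤ 1 / 2 := (lt_of_lt_of_le hσlt ((min_le_right _ _).trans (min_le_left _ _))).le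
  have hση : σ < min η₄ η₅ := lt_of_lt_of_le hσlt ((min_le_right _ _).trans (min_le_right _ _))
  have hσ3 : σ ^ 3 ≤ σ := pow_le_of_le_one hσ.le (by linarith) (by norm_num)
  have hσcube4 : σ ^ 3 < η₄ := lt_of_le_of_lt hσ3 (lt_of_lt_of_le hση (min_le_left _ _))
  have hσcube5 : σ ^ 3 < η₅ := lt_of_le_of_lt hσ3 (lt_of_lt_of_le hση (min_le_right _ _))
  have hg4 : ∀ b, η₄ ≤ b → g b = 0 := fun b hb =>
    hg0 b ((((min_le_left _ _).trans (min_le_left _ _)).trans (min_le_left _ _)).trans hb)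
  have hg5 : ∀ b, η₅ ≤ b → g b = 0 := fun b hb =>
    hg0 b ((((min_le_left _ _).trans (min_le_left _ _)).trans (min_le_right _ _)).trans hb)
  have hg6 : ∀ b, η₆ ≤ b → g b = 0 := fun b hb =>
    hg0 b (((min_le_left _ _).trans (min_le_right _ _)).trans hb)
  have hgY : ∀ b, ηY ≤ b → g b = 0 := fun b hb => hg0 b ((min_le_right _ _).trans hb)
  obtain ⟨CgY, hCgY0, hCgY⟩ := HY g hg hgY
  -- a uniform bound for `χ` on `[0, τ] × 𝕋³`
  have hKc : IsCompact (Set.Icc (0 : ℝ) τ ×ˢ (univ : Set (UnitAddTorus (Fin 3)))) :=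
    isCompact_Icc.prod isCompact_univ
  obtain ⟨Cχ, hCχ⟩ := hKc.exists_bound_of_continuousOn hχ.continuousOn
  have hχb : ∀ t ∈ Set.Icc (0 : ℝ) τ, ∀ x, |χ (t, x)| ≤ Cχ := fun t ht x => by
    simpa only [Real.norm_eq_abs] using hCχ (t, x) ⟨ht, mem_univ _⟩
  -- the law
  set G : (N : ℕ) → Measure (Config (N + 1) (Fin 3) T3) :=
    fun N => localGibbsLaw σ (fun _ => a) (fun _ => u) (fun _ => θ) N (Φ N) with hG
  have hPN : ∀ N, IsProbabilityMeasure (G N) := fun N =>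
    isProbabilityMeasure_localGibbsLaw continuous_const continuous_const continuous_const
      (fun _ => ha) (fun _ => hθ) hσhalf N (Φ N)
  refine ⟨1 / 4, by norm_num, ?_⟩
  intro r hr hrlt L hL
  have hL0 : (0 : ℝ) ≤ L := zero_le_one.trans hL
  -- the uniform Enskog bound
  set CE : ℝ := Cχ * CgY * ((3 / (Real.pi * r ^ 3)) ^ 2 *
    (2 * L * (2 * L) * (sphereMeasure : Measure (Metric.sphere (0 : V3) 1)).real univ)) *
      (volume : Measure (UnitAddTorus (Fin 3))).real univ with hCE
  have hEbound : ∀ (k l : Fin 3) (N : ℕ), ∀ t ∈ Set.Icc (0 : ℝ) τ, ∀ z,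
      |enskogRate σ N χ g (evenMarkTrunc k l L) r t z| ≤ CE := fun k l N t ht z =>
    abs_enskogRate_le_unif k l (hχb t ht) hCgY hσ.le hL0 hr N z
  -- ONE pair `(k, l)` at a time
  have key : ∀ k l : Fin 3, ∃ κ₀ : ℝ, 0 < κ₀ ∧ ∀ κ : ℝ, 0 < κ → κ < κ₀ → ∃ N₀ : ℕ, ∀ N : ℕ, N₀ ≤ N →
      |∫ t in Set.Icc (0 : ℝ) τ,
          ∫ z, evenTubeStat σ N χ g (evenMarkTrunc k l L) r κ t ((Φ N).flow t z) ∂(G N)| ≤ η := by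
    intro k l
    set Θb : ℝ := ∫ p : V3 × V3, sphereMark (evenMarkTrunc k l L) p.1 p.2 *
      (localMaxwellian 1 θ u p.1 * localMaxwellian 1 θ u p.2) with hΘb
    set I : ℝ := ∫ t in Set.Icc (0 : ℝ) τ, ∫ x : UnitAddTorus (Fin 3), χ (t, x) with hI
    -- the tube side: H5 at accuracy η/2
    obtain ⟨κ₀, hκ₀, H5'⟩ := H5 σ a θ u τ χ g k l L r hσ hσ5 hσcube5 ha hθ hτ hχ hg hg5 hL hr hrlt
      (η / 2) (by positivity)
    refine ⟨κ₀, hκ₀, fun κ hκ hκlt => ?_⟩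
    obtain ⟨N₅, hN₅⟩ := H5' κ hκ hκlt Φ
    -- the Enskog side: H4 pointwise in `t`, then dominated convergence in `t`
    have h4t : ∀ t : ℝ, Tendsto (fun N : ℕ => ∫ z, enskogRate σ N χ g (evenMarkTrunc k l L) r t z ∂(G N))
        atTop (𝓝 ((∫ x : UnitAddTorus (Fin 3), χ (t, x)) * g (σ ^ 3) * contactValue (σ ^ 3) * Θb)) :=
      fun t => H4 σ a θ u χ g k l L r t hσ hσ4 hσcube4 ha hθ hχ hg hg4 hL0 hr hrlt Φ
    -- joint measurability of `(t, z) ↦ e_t(z)` for each `N` (via `e = σ⁻³ (A − W)`)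
    have hmeasE : ∀ N, Measurable (fun p : ℝ × Config (N + 1) (Fin 3) T3 =>
        enskogRate σ N χ g (evenMarkTrunc k l L) r p.1 p.2) := by
      intro N
      obtain ⟨hmeasW, -⟩ := H6 σ N χ g k l L r κ τ hσ hχ hg hg6 hL0 hr hκ.le
      have hmeasA := Summit.AtomisticToContinuum.HydrodynamicLimit.Theorems.measurable_tubeStat_uncurry σ N
        hχ hg (continuous_evenMarkTrunc k l L) r r 1 κ
      have hσ3ne : σ ^ 3 ≠ 0 := pow_ne_zero 3 hσ.ne'
      have heq : (fun p : ℝ × Config (N + 1) (Fin 3) T3 => enskogRate σ N χ g (evenMarkTrunc k l L) r p.1 p.2)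
          = fun p => (σ ^ 3)⁻¹ * (tubeStat σ N χ g (evenMarkTrunc k l L) r r 1 κ p.1 p.2 -
              evenTubeStat σ N χ g (evenMarkTrunc k l L) r κ p.1 p.2) := by
        funext p
        rw [evenTubeStat_def]
        field_simp
        ring
      rw [heq]
      exact (hmeasA.sub hmeasW).const_mul _
    -- the `t ↦ E e_t` are measurable and uniformly bounded on `[0, τ]`
    have hFmeas : ∀ N, AEStronglyMeasurable
        (fun t => ∫ z, enskogRate σ N χ g (evenMarkTrunc k l L) r t z ∂(G N))
        (volume.restrict (Set.Icc (0 : ℝ) τ)) := fun N =>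
      ((hmeasE N).stronglyMeasurable.integral_prod_right' (ν := G N)).aestronglyMeasurable
    have hFbound : ∀ N, ∀ᵐ t ∂(volume.restrict (Set.Icc (0 : ℝ) τ)),
        ‖∫ z, enskogRate σ N χ g (evenMarkTrunc k l L) r t z ∂(G N)‖ ≤ CE := by
      intro N
      haveI := hPN N
      filter_upwards [ae_restrict_mem measurableSet_Icc] with t ht
      have h := norm_integral_le_of_norm_le_const (μ := G N)
        (f := fun z => enskogRate σ N χ g (evenMarkTrunc k l L) r t z) (C := CE)
        (Eventually.of_forall fun z => by simpa only [Real.norm_eq_abs] using hEbound k l N t ht z)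
      simpa only [probReal_univ, mul_one] using h
    have hDCT : Tendsto (fun N : ℕ => ∫ t in Set.Icc (0 : ℝ) τ,
          ∫ z, enskogRate σ N χ g (evenMarkTrunc k l L) r t z ∂(G N)) atTop
        (𝓝 (∫ t in Set.Icc (0 : ℝ) τ,
          (∫ x : UnitAddTorus (Fin 3), χ (t, x)) * g (σ ^ 3) * contactValue (σ ^ 3) * Θb)) :=
      tendsto_integral_of_dominated_convergence (fun _ => CE) hFmeas (integrable_const CE) hFbound
        (Eventually.of_forall h4t)
    have hlim : ∫ t in Set.Icc (0 : ℝ) τ,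
        (∫ x : UnitAddTorus (Fin 3), χ (t, x)) * g (σ ^ 3) * contactValue (σ ^ 3) * Θb
        = g (σ ^ 3) * contactValue (σ ^ 3) * Θb * I := by
      rw [hI, ← integral_const_mul]
      refine integral_congr_ae (Eventually.of_forall fun t => ?_)
      simp only
      ring
    rw [hlim] at hDCT
    obtain ⟨N₄, hN₄⟩ := Metric.tendsto_atTop.1 hDCT (η / 2 / σ ^ 3) (by positivity)
    refine ⟨max N₄ N₅, fun N hN => ?_⟩
    have hN4' := hN₄ N ((le_max_left _ _).trans hN)
    have hN5' := hN₅ N ((le_max_right _ _).trans hN)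
    haveI := hPN N
    -- regularity of `W` (S6) and `A` (tree) for this `N`
    obtain ⟨hmeasW, BW, hBW⟩ := H6 σ N χ g k l L r κ τ hσ hχ hg hg6 hL0 hr hκ.le
    have hmeasA := Summit.AtomisticToContinuum.HydrodynamicLimit.Theorems.measurable_tubeStat_uncurry σ N
      hχ hg (continuous_evenMarkTrunc k l L) r r 1 κ
    obtain ⟨BA, hBA⟩ := Summit.AtomisticToContinuum.HydrodynamicLimit.Theorems.exists_bound_tubeStat σ N
      hχ hg (exists_abs_evenMarkTrunc_le k l hL0) hr r zero_le_one hκ.le τ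
    have hmeasWt : ∀ t, Measurable (fun z => evenTubeStat σ N χ g (evenMarkTrunc k l L) r κ t z) :=
      fun t => Measurable.of_uncurry_left
        (f := fun (t : ℝ) (z : Config (N + 1) (Fin 3) T3) => evenTubeStat σ N χ g (evenMarkTrunc k l L) r κ t z)
        hmeasW
    have hmeasAt : ∀ t, Measurable (fun z => tubeStat σ N χ g (evenMarkTrunc k l L) r r 1 κ t z) :=
      fun t => Measurable.of_uncurry_left
        (f := fun (t : ℝ) (z : Config (N + 1) (Fin 3) T3) => tubeStat σ N χ g (evenMarkTrunc k l L) r r 1 κ t z)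
        hmeasA
    have hmeasEt : ∀ t, Measurable (fun z => enskogRate σ N χ g (evenMarkTrunc k l L) r t z) :=
      fun t => Measurable.of_uncurry_left
        (f := fun (t : ℝ) (z : Config (N + 1) (Fin 3) T3) => enskogRate σ N χ g (evenMarkTrunc k l L) r t z)
        (hmeasE N)
    -- stationarity: the flow disappears under the Gibbs mean
    have hstat : ∀ t, ∫ z, evenTubeStat σ N χ g (evenMarkTrunc k l L) r κ t ((Φ N).flow t z) ∂(G N)
        = ∫ z, evenTubeStat σ N χ g (evenMarkTrunc k l L) r κ t z ∂(G N) := fun t =>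
      integral_comp_flow_localGibbsLaw_const σ a θ u N (Φ N) t (hmeasWt t).aestronglyMeasurable
    -- decomposition of the static mean at each `t ∈ [0, τ]`
    have hdec : ∀ t ∈ Set.Icc (0 : ℝ) τ,
        ∫ z, evenTubeStat σ N χ g (evenMarkTrunc k l L) r κ t z ∂(G N)
          = (∫ z, tubeStat σ N χ g (evenMarkTrunc k l L) r r 1 κ t z ∂(G N))
            - σ ^ 3 * ∫ z, enskogRate σ N χ g (evenMarkTrunc k l L) r t z ∂(G N) := by
      intro t ht
      have hiA : Integrable (fun z => tubeStat σ N χ g (evenMarkTrunc k l L) r r 1 κ t z) (G N) :=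
        Integrable.of_bound (hmeasAt t).aestronglyMeasurable BA
          (Eventually.of_forall fun z => by simpa only [Real.norm_eq_abs] using hBA t ht z)
      have hiE : Integrable (fun z => σ ^ 3 * enskogRate σ N χ g (evenMarkTrunc k l L) r t z) (G N) :=
        (Integrable.of_bound (hmeasEt t).aestronglyMeasurable CE
          (Eventually.of_forall fun z => by
            simpa only [Real.norm_eq_abs] using hEbound k l N t ht z)).const_mul _
      simp_rw [evenTubeStat_def]
      rw [integral_sub hiA hiE, integral_const_mul]
    -- the time integral of the static mean splits
    have hiAt : Integrable (fun t => ∫ z, tubeStat σ N χ g (evenMarkTrunc k l L) r r 1 κ t z ∂(G N))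
        (volume.restrict (Set.Icc (0 : ℝ) τ)) := by
      refine Integrable.of_bound
        ((hmeasA.stronglyMeasurable.integral_prod_right' (ν := G N)).aestronglyMeasurable) BA ?_
      filter_upwards [ae_restrict_mem measurableSet_Icc] with t ht
      have h := norm_integral_le_of_norm_le_const (μ := G N)
        (f := fun z => tubeStat σ N χ g (evenMarkTrunc k l L) r r 1 κ t z) (C := BA)
        (Eventually.of_forall fun z => by simpa only [Real.norm_eq_abs] using hBA t ht z)
      simpa only [probReal_univ, mul_one] using h
    have hiEt : Integrable (fun t => σ ^ 3 * ∫ z, enskogRate σ N χ g (evenMarkTrunc k l L) r t z ∂(G N))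
        (volume.restrict (Set.Icc (0 : ℝ) τ)) :=
      (Integrable.of_bound (hFmeas N) CE (hFbound N)).const_mul _
    have hsplit : ∫ t in Set.Icc (0 : ℝ) τ,
          ∫ z, evenTubeStat σ N χ g (evenMarkTrunc k l L) r κ t ((Φ N).flow t z) ∂(G N)
        = (∫ t in Set.Icc (0 : ℝ) τ, ∫ z, tubeStat σ N χ g (evenMarkTrunc k l L) r r 1 κ t z ∂(G N))
          - σ ^ 3 * ∫ t in Set.Icc (0 : ℝ) τ,
              ∫ z, enskogRate σ N χ g (evenMarkTrunc k l L) r t z ∂(G N) := by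
      rw [← integral_const_mul, ← integral_sub hiAt hiEt]
      refine setIntegral_congr_fun measurableSet_Icc fun t ht => ?_
      rw [hstat t, hdec t ht]
    -- the estimate
    rw [hsplit]
    set EA : ℝ := ∫ t in Set.Icc (0 : ℝ) τ, ∫ z, tubeStat σ N χ g (evenMarkTrunc k l L) r r 1 κ t z ∂(G N)
      with hEA
    set EE : ℝ := ∫ t in Set.Icc (0 : ℝ) τ, ∫ z, enskogRate σ N χ g (evenMarkTrunc k l L) r t z ∂(G N)
      with hEE
    have h5 : |EA - σ ^ 3 * g (σ ^ 3) * contactValue (σ ^ 3) * Θb * I| ≤ η / 2 := hN5'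
    have h4 : |EE - g (σ ^ 3) * contactValue (σ ^ 3) * Θb * I| < η / 2 / σ ^ 3 := by
      rw [← Real.dist_eq]; exact hN4'
    have hσ3pos : 0 < σ ^ 3 := pow_pos hσ 3
    have h4' : σ ^ 3 * |EE - g (σ ^ 3) * contactValue (σ ^ 3) * Θb * I| ≤ η / 2 := by
      have h := mul_lt_mul_of_pos_left h4 hσ3pos
      have hc : σ ^ 3 * (η / 2 / σ ^ 3) = η / 2 := by field_simp
      rw [hc] at h
      exact h.le
    calc |EA - σ ^ 3 * EE|
        = |(EA - σ ^ 3 * g (σ ^ 3) * contactValue (σ ^ 3) * Θb * I)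
            - σ ^ 3 * (EE - g (σ ^ 3) * contactValue (σ ^ 3) * Θb * I)| := by ring_nf
      _ ≤ |EA - σ ^ 3 * g (σ ^ 3) * contactValue (σ ^ 3) * Θb * I|
            + |σ ^ 3 * (EE - g (σ ^ 3) * contactValue (σ ^ 3) * Θb * I)| := abs_sub _ _
      _ = |EA - σ ^ 3 * g (σ ^ 3) * contactValue (σ ^ 3) * Θb * I|
            + σ ^ 3 * |EE - g (σ ^ 3) * contactValue (σ ^ 3) * Θb * I| := by
          rw [abs_mul, abs_of_pos hσ3pos]
      _ ≤ η / 2 + η / 2 := add_le_add h5 h4'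
      _ = η := by ring
  -- all nine pairs at once
  choose κf hκf hNf using key
  refine ⟨Finset.univ.inf' Finset.univ_nonempty (fun p : Fin 3 × Fin 3 => κf p.1 p.2), ?_, ?_⟩
  · exact (Finset.lt_inf'_iff _).2 fun p _ => hκf p.1 p.2
  · intro κ hκ hκlt
    have hκ' : ∀ k l : Fin 3, κ < κf k l := fun k l =>
      lt_of_lt_of_le hκlt (Finset.inf'_le (fun p : Fin 3 × Fin 3 => κf p.1 p.2) (Finset.mem_univ (k, l)))
    choose Nf hNf' using fun k l => hNf k l κ hκ (hκ' k l)
    refine ⟨Finset.univ.sup (fun p : Fin 3 × Fin 3 => Nf p.1 p.2), fun N hN k l => hNf' k l N ?_⟩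
    exact (Finset.le_sup (f := fun p : Fin 3 × Fin 3 => Nf p.1 p.2) (Finset.mem_univ (k, l))).trans hN

/-! ## Feeding the named fact `HardSphereContactTheorem` -/

/-- **S3 at rung 0 modulo the tube-side mean, from the NAMED contact theorem** (`HardSphereContactTheorem`, Literature debt): the
corollary of `meanEnskogRung0_of_tubeMean` and the bridge `contactStatementLG_of_contactTheorem`. -/
theorem meanEnskogRung0_of_tubeMean_of_contactTheorem :
    ((∃ σ₁ : ℝ, 0 < σ₁ ∧ ∀ σ : ℝ, 0 < σ → σ < σ₁ → ∀ ζ : ℝ, 0 < ζ → ∃ δ₁ : ℝ, 0 < δ₁ ∧ ∀ δ : ℝ, 0 < δ → δ ≤ δ₁ →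
      ∃ N₀ : ℕ, ∀ N : ℕ, N₀ ≤ N → ∀ (a θ : ℝ) (u : V3), 0 < a → 0 < θ →
      ∀ Φ : HardSphereFlow (Torus.geometry (Fin 3)) (hsDiameter σ N) (N + 1),
      ∀ i j : Fin (N + 1), i ≠ j → ∀ S : Set V3, MeasurableSet S → S ⊆ {q | 1 < ‖q‖ ∧ ‖q‖ ≤ 1 + δ} →
        |(localGibbsLaw σ (fun _ => a) (fun _ => u) (fun _ => θ) N Φ).real
            {z | Torus.reprSym ((z i).1 - (z j).1) ∈ hsDiameter σ N • S}
          - contactValue (σ ^ 3) * hsDiameter σ N ^ 3 * (volume S).toReal|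
          ≤ ζ * hsDiameter σ N ^ 3 * (volume S).toReal) →
      ∃ η₁ : ℝ, 0 < η₁ ∧ ∃ σ₀ : ℝ, 0 < σ₀ ∧ ∀ (σ a θ : ℝ) (u : V3) (τ : ℝ) (χ : ℝ × UnitAddTorus (Fin 3) → ℝ)
      (g : ℝ → ℝ) (k l : Fin 3) (L r : ℝ),
      0 < σ → σ < σ₀ → σ ^ 3 < η₁ → 0 < a → 0 < θ → 0 < τ → Continuous χ → Continuous g →
      (∀ b, η₁ ≤ b → g b = 0) → 1 ≤ L → 0 < r → r < 1 / 4 →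
      ∀ η : ℝ, 0 < η → ∃ κ₀ : ℝ, 0 < κ₀ ∧ ∀ κ : ℝ, 0 < κ → κ < κ₀ →
      ∀ Φ : (N : ℕ) → HardSphereFlow (Torus.geometry (Fin 3)) (hsDiameter σ N) (N + 1), ∃ N₀ : ℕ, ∀ N : ℕ, N₀ ≤ N →
        |(∫ t in Set.Icc (0 : ℝ) τ, ∫ z, tubeStat σ N χ g (evenMarkTrunc k l L) r r 1 κ t z
            ∂(localGibbsLaw σ (fun _ => a) (fun _ => u) (fun _ => θ) N (Φ N)))
          - σ ^ 3 * g (σ ^ 3) * contactValue (σ ^ 3) *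
            (∫ p : V3 × V3, sphereMark (evenMarkTrunc k l L) p.1 p.2 *
              (localMaxwellian 1 θ u p.1 * localMaxwellian 1 θ u p.2)) *
            ∫ t in Set.Icc (0 : ℝ) τ, ∫ x : UnitAddTorus (Fin 3), χ (t, x)| ≤ η) →
    (Literature.MathematicalPhysics.StatisticalMechanics.HardSphereContactTheorem) →
    ∃ η₀ : ℝ, 0 < η₀ ∧ ∀ (a θ : ℝ) (u : V3), 0 < a → 0 < θ → ∃ σ₀ : ℝ, 0 < σ₀ ∧ ∀ σ : ℝ, 0 < σ → σ < σ₀ →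
      ∀ Φ : (N : ℕ) → HardSphereFlow (Torus.geometry (Fin 3)) (hsDiameter σ N) (N + 1),
      ∀ τ : ℝ, 0 < τ → ∀ χ : ℝ × UnitAddTorus (Fin 3) → ℝ, Continuous χ → ∀ g : ℝ → ℝ, Continuous g →
      (∀ b, η₀ ≤ b → g b = 0) →
      ∀ η : ℝ, 0 < η → ∃ r₀ : ℝ, 0 < r₀ ∧ ∀ r : ℝ, 0 < r → r < r₀ →
      ∀ L : ℝ, 1 ≤ L → ∃ κ₀ : ℝ, 0 < κ₀ ∧ ∀ κ : ℝ, 0 < κ → κ < κ₀ → ∃ N₀ : ℕ, ∀ N : ℕ, N₀ ≤ N →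
      ∀ k l : Fin 3,
        |∫ t in Set.Icc (0 : ℝ) τ,
            ∫ z, evenTubeStat σ N χ g (evenMarkTrunc k l L) r κ t ((Φ N).flow t z)
              ∂(localGibbsLaw σ (fun _ => a) (fun _ => u) (fun _ => θ) N (Φ N))| ≤ η  :=
  fun hH5 hCT =>
  meanEnskogRung0_of_tubeMean hH5 (contactStatementLG_of_contactTheorem hCT)

end Summit.AtomisticToContinuum.HydrodynamicLimit.Theorems.EvenStressEnskog

end
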